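import Mathlib
import Summits.QuantumFields.YangMills.Theorems.EquipartitionCriticalityCriticalContinuumLimitStubAdmissibleGivesGapTorusRP
import HarnessLib

/-!
# `ContinuumLegGivenGap` (stmt-QuantumFields-15828), line `Sketch` (reshape 17-RP): `stub_rpFormsCS`

Support file for the crux item stmt-QuantumFields-15828
(`Summit.QuantumFields.YangMills.Theses.ConvexGribovBody.ContinuumLegGivenGap`), line `Sketch`,
registered stub `stub_rpFormsCS` — the positivity layer of the reflection-positivity core of the odd
torus.

On the torus of side `2S+1` at `β ≥ 0`, with `Ũ = torusLift (2S+1) U`, `Θ = gaugeTimeReflect` (the bond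
time reflection `x₀ ↦ -1-x₀` of `ℤ⁴` gauge fields) and `τ = gaugeTimeShift`, the bond form
`Q₀(X,Y) = ∫ X(Θ Ũ) Y(Ũ) dμ` and the site form `Q₁(X,Y) = ∫ X(Θ Ũ) Y(τ Ũ) dμ` are, on real bounded
measurable cylinder observables supported on links based at times `0 ≤ x₀ ≤ v` (`v + 2 ≤ S`), symmetric
positive semi-definite bilinear forms; hence `Qᵢ(X,Y)² ≤ Qᵢ(X,X) Qᵢ(Y,Y)` and `Qᵢ(X,X) ≥ 0`.

* positivity: the tree's `torus_rp_bond` / `torus_rp_site` (reflection positivity of Wilson's action on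
  the odd torus, `CriticalContinuumLimit.AdmissibleGap`) applied to the complexification of the real
  combination `X + tY`;
* symmetry: `Θ ∘ Θ = id`, `τ Θ τ = Θ`, the lift intertwiners `Θ ∘ lift = lift ∘ T_{-2e₀} ∘ Θ_T`,
  `τ ∘ lift = lift ∘ T_{-e₀}` (`ClusteringToYangMills.Reconstructible`) and the `Θ_T`- and translation
  invariance of the torus Wilson state;
* Cauchy–Schwarz: the discriminant of the nonnegative real quadratic `t ↦ Qᵢ(X+tY, X+tY)`.

References: K. Osterwalder, E. Seiler, Ann. Phys. 110 (1978) 440, §2; J. Glimm, A. Jaffe,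
*Quantum Physics* (1987) §6.1.
-/

noncomputable section

namespace Summit.QuantumFields.YangMills.Theorems.ContinuumLegGivenGap

open scoped ComplexConjugate
open Filter Topology MeasureTheory
open Literature.MathematicalPhysics.QuantumFieldTheory Literature.MathematicalPhysics.QuantumLattice
  Literature.MathematicalPhysics.AQFT Literature.Probability.LatticeModels
open Summit.QuantumFields.YangMills.Theorems.CriticalContinuumLimit.AdmissibleGap
  (maxTime torus_rp_bond torus_rp_site)
open Summit.QuantumFields.YangMills.Theorems.ClusteringToYangMills.Reconstructible

/-! ### Abstract layer: Cauchy–Schwarz from positivity and symmetry of an integral pairing -/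

/-- **Cauchy–Schwarz by the discriminant.** If the real quadratic `t ↦ ∫ (a + t b)(c + t d) dμ` is
nonnegative and the pairing is symmetric (`∫ b c = ∫ a d`), then `(∫ a d)² ≤ (∫ a c)(∫ b d)` and
`0 ≤ ∫ a c`. [folklore] -/
theorem rpForms_sq_integral_le {Ω : Type*} [MeasurableSpace Ω] {μ : Measure Ω} {a b c d : Ω → ℝ}
    (hac : Integrable (fun ω => a ω * c ω) μ) (had : Integrable (fun ω => a ω * d ω) μ)
    (hbc : Integrable (fun ω => b ω * c ω) μ) (hbd : Integrable (fun ω => b ω * d ω) μ)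
    (hpsd : ∀ t : ℝ, 0 ≤ ∫ ω, (a ω + t * b ω) * (c ω + t * d ω) ∂μ)
    (hsymm : ∫ ω, b ω * c ω ∂μ = ∫ ω, a ω * d ω ∂μ) :
    (∫ ω, a ω * d ω ∂μ) ^ 2 ≤ (∫ ω, a ω * c ω ∂μ) * (∫ ω, b ω * d ω ∂μ) ∧
      0 ≤ ∫ ω, a ω * c ω ∂μ := by
  have expand : ∀ t : ℝ, ∫ ω, (a ω + t * b ω) * (c ω + t * d ω) ∂μ =
      (∫ ω, b ω * d ω ∂μ) * (t * t) + (2 * ∫ ω, a ω * d ω ∂μ) * t + ∫ ω, a ω * c ω ∂μ := by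
    intro t
    have i1 : Integrable (fun ω => a ω * c ω + t * (b ω * c ω)) μ := hac.add (hbc.const_mul t)
    have i2 : Integrable (fun ω => t * (a ω * d ω) + t * t * (b ω * d ω)) μ :=
      (had.const_mul t).add (hbd.const_mul (t * t))
    have e1 : ∫ ω, (a ω + t * b ω) * (c ω + t * d ω) ∂μ =
        ∫ ω, (a ω * c ω + t * (b ω * c ω)) + (t * (a ω * d ω) + t * t * (b ω * d ω)) ∂μ := by
      congr 1 with ω
      ring
    rw [e1, integral_add i1 i2, integral_add hac (hbc.const_mul t),
      integral_add (had.const_mul t) (hbd.const_mul (t * t)), integral_const_mul, integral_const_mul,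
      integral_const_mul, hsymm]
    ring
  refine ⟨?_, ?_⟩
  · have h := discrim_le_zero fun t => (hpsd t).trans_eq (expand t)
    rw [discrim] at h
    nlinarith [h]
  · have h0 := hpsd 0
    rw [expand 0] at h0
    simpa using h0

/-- A product of two bounded measurable real functions is integrable for a finite measure. [folklore] -/
theorem rpForms_integrable_mul {Ω : Type*} [MeasurableSpace Ω] {μ : Measure Ω} [IsFiniteMeasure μ]
    {f g : Ω → ℝ} (hf : Measurable f) (hg : Measurable g) (hfb : ∃ C : ℝ, ∀ ω, |f ω| ≤ C)
    (hgb : ∃ C : ℝ, ∀ ω, |g ω| ≤ C) : Integrable (fun ω => f ω * g ω) μ := by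
  obtain ⟨Cf, hCf⟩ := hfb
  obtain ⟨Cg, hCg⟩ := hgb
  refine Integrable.of_bound (hf.mul hg).aestronglyMeasurable (Cf * Cg) (ae_of_all _ fun ω => ?_)
  rw [Real.norm_eq_abs, abs_mul]
  exact mul_le_mul (hCf ω) (hCg ω) (abs_nonneg _) ((abs_nonneg _).trans (hCf ω))

/-- The real part of `∫ conj a · b` for real `a, b` is `∫ a b`. [folklore] -/
theorem rpForms_re_integral_conj_ofReal_mul {Ω : Type*} [MeasurableSpace Ω] (μ : Measure Ω)
    (a b : Ω → ℝ) : (∫ ω, conj ((a ω : ℂ)) * (b ω : ℂ) ∂μ).re = ∫ ω, a ω * b ω ∂μ := by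
  simp only [Complex.conj_ofReal, ← Complex.ofReal_mul, integral_complex_ofReal, Complex.ofReal_re]

/-! ### The torus layer: invariances, symmetry and positivity of the two forms -/

variable {G : Type} [Group G] [TopologicalSpace G] [IsTopologicalGroup G] [CompactSpace G]
  [MeasurableSpace G] [BorelSpace G] (r : LatticeRep G) (β : ℝ)

/-- Torus Wilson integrals are invariant under the translations `T_v`. [folklore] -/
theorem rpForms_integral_comp_shift {L : ℕ} [NeZero L] (v : Fin 4 → ZMod L)
    (h : GaugeConfig 4 L G → ℝ) :
    ∫ U, h (torusConfigShift v U) ∂(wilsonMeasure r.ρ β) = ∫ U, h U ∂(wilsonMeasure r.ρ β) :=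
  wilsonExpectation_comp_torusConfigShift r.ρ β v h

/-- Torus Wilson integrals are invariant under `U ↦ T_{c e₀} (Θ_T U)`. [folklore] -/
theorem rpForms_integral_comp_shift_timeReflect {L : ℕ} [NeZero L] (c : ZMod L)
    (h : GaugeConfig 4 L G → ℝ) :
    ∫ U, h (torusConfigShift (Pi.single 0 c) (GaugeConfig.timeReflect U)) ∂(wilsonMeasure r.ρ β) =
      ∫ U, h U ∂(wilsonMeasure r.ρ β) := by
  have h1 := wilsonExpectation_comp_timeReflect r.ρ r.continuous β
    (h ∘ torusConfigShift (Pi.single 0 c))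
  rw [wilsonExpectation_comp_torusConfigShift] at h1
  exact h1

/-- **Symmetry of the bond form**: `∫ X(Θ Ũ) Y(Ũ) = ∫ Y(Θ Ũ) X(Ũ)` (from `Θ ∘ Θ = id`, the lift
intertwiner `Θ ∘ lift = lift ∘ T_{-2e₀} ∘ Θ_T` and the invariances of the Wilson state). [folklore] -/
theorem rpForms_bond_symm {L : ℕ} [NeZero L] (X Y : LGConfig 4 G → ℝ) :
    ∫ U, X (gaugeTimeReflect (torusLift L U)) * Y (torusLift L U) ∂(wilsonMeasure r.ρ β) =
      ∫ U, Y (gaugeTimeReflect (torusLift L U)) * X (torusLift L U) ∂(wilsonMeasure r.ρ β) := by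
  have key : (fun U : GaugeConfig 4 L G => X (gaugeTimeReflect (torusLift L U)) * Y (torusLift L U)) =
      fun U => (fun V : GaugeConfig 4 L G => Y (gaugeTimeReflect (torusLift L V)) * X (torusLift L V))
        (torusConfigShift (Pi.single 0 (-2)) (GaugeConfig.timeReflect U)) := by
    funext U
    dsimp only
    rw [← gaugeTimeReflect_torusLift, gaugeTimeReflect_gaugeTimeReflect, mul_comm]
  rw [key]
  exact rpForms_integral_comp_shift_timeReflect r β (-2)
    fun V => Y (gaugeTimeReflect (torusLift L V)) * X (torusLift L V)

/-- **Symmetry of the site form**: `∫ X(Θ Ũ) Y(τ Ũ) = ∫ Y(Θ Ũ) X(τ Ũ)` (from `Θ ∘ Θ = id`,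
`τ Θ τ = Θ`, the two lift intertwiners and the invariances of the Wilson state). [folklore] -/
theorem rpForms_site_symm {L : ℕ} [NeZero L] (X Y : LGConfig 4 G → ℝ) :
    ∫ U, X (gaugeTimeReflect (torusLift L U)) * Y (gaugeTimeShift (torusLift L U))
        ∂(wilsonMeasure r.ρ β) =
      ∫ U, Y (gaugeTimeReflect (torusLift L U)) * X (gaugeTimeShift (torusLift L U))
        ∂(wilsonMeasure r.ρ β) := by
  have key : (fun U : GaugeConfig 4 L G =>
      X (gaugeTimeReflect (torusLift L U)) * Y (gaugeTimeShift (torusLift L U))) =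
      fun U => (fun V : GaugeConfig 4 L G =>
          Y (gaugeTimeReflect (torusLift L V)) * X (gaugeTimeShift (torusLift L V)))
        (torusConfigShift (Pi.single 0 (-2)) (GaugeConfig.timeReflect
          (torusConfigShift (Pi.single 0 (-1)) U))) := by
    funext U
    dsimp only
    rw [← gaugeTimeReflect_torusLift, ← gaugeTimeShift_torusLift, gaugeTimeReflect_gaugeTimeReflect,
      gaugeTimeShift_gaugeTimeReflect_gaugeTimeShift, mul_comm]
  rw [key, rpForms_integral_comp_shift r β (Pi.single 0 (-1)) fun W => (fun V : GaugeConfig 4 L G =>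
      Y (gaugeTimeReflect (torusLift L V)) * X (gaugeTimeShift (torusLift L V)))
    (torusConfigShift (Pi.single 0 (-2)) (GaugeConfig.timeReflect W))]
  exact rpForms_integral_comp_shift_timeReflect r β (-2)
    fun V => Y (gaugeTimeReflect (torusLift L V)) * X (gaugeTimeShift (torusLift L V))

omit [Group G] [TopologicalSpace G] [IsTopologicalGroup G] [CompactSpace G] [MeasurableSpace G]
  [BorelSpace G] in
/-- Real linear combinations of cylinder observables are cylinder observables on the union of the
supports. [folklore] -/
theorem rpForms_isCylinder_add_mul {X Y : LGConfig 4 G → ℝ} {ΛX ΛY : Finset (Literature.MathematicalPhysics.QuantumLattice.ZdEdge 4)}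
    (hX : IsCylinder X ΛX) (hY : IsCylinder Y ΛY) (t : ℝ) :
    IsCylinder (fun W => X W + t * Y W) (ΛX ∪ ΛY) := by
  intro U V hUV
  have eX : X U = X V := hX fun e he => hUV e (by rw [Finset.coe_union]; exact Or.inl he)
  have eY : Y U = Y V := hY fun e he => hUV e (by rw [Finset.coe_union]; exact Or.inr he)
  simp only [eX, eY]

/-- **Reflection positivity of the odd torus for real observables** (bond plane and site plane): for
a real bounded measurable cylinder observable `F` of `ℤ⁴` supported on links based at times
`0 ≤ x₀ ≤ v`, `v + 2 ≤ S`, on the torus of side `2S+1` at `β ≥ 0` one has `0 ≤ ∫ F(Θ Ũ) F(Ũ)` and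
`0 ≤ ∫ F(Θ Ũ) F(τ Ũ)` (the tree's `torus_rp_bond` / `torus_rp_site` for the complexification). [folklore] -/
theorem rpForms_rp_real {β : ℝ} (hβ : 0 ≤ β) {S v : ℕ} (hv : v + 2 ≤ S) {F : LGConfig 4 G → ℝ}
    (hFm : Measurable F) (hFb : ∃ C : ℝ, ∀ U, |F U| ≤ C) {Λ : Finset (Literature.MathematicalPhysics.QuantumLattice.ZdEdge 4)}
    (hF : IsCylinder F Λ) (hΛ : ∀ e ∈ Λ, 0 ≤ e.1 0 ∧ e.1 0 ≤ (v : ℤ)) :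
    0 ≤ ∫ U : GaugeConfig 4 (2 * S + 1) G, F (gaugeTimeReflect (torusLift (2 * S + 1) U)) *
        F (torusLift (2 * S + 1) U) ∂(wilsonMeasure r.ρ β) ∧
      0 ≤ ∫ U : GaugeConfig 4 (2 * S + 1) G, F (gaugeTimeReflect (torusLift (2 * S + 1) U)) *
        F (gaugeTimeShift (torusLift (2 * S + 1) U)) ∂(wilsonMeasure r.ρ β) := by
  obtain ⟨C, hC⟩ := hFb
  have hFcm : Measurable fun U => (F U : ℂ) := Complex.measurable_ofReal.comp hFm
  have hFcb : ∃ C : ℝ, ∀ U, ‖(F U : ℂ)‖ ≤ C :=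
    ⟨C, fun U => by rw [Complex.norm_real, Real.norm_eq_abs]; exact hC U⟩
  have hFc : IsCylinder (fun U => (F U : ℂ)) Λ := by
    intro U V hUV
    exact congrArg Complex.ofReal (hF hUV)
  have hΛpos : (↑Λ : Set (Literature.MathematicalPhysics.QuantumLattice.ZdEdge 4)) ⊆ posTimeEdges :=
    fun e he => mem_posTimeEdges.2 (hΛ e (Finset.mem_coe.1 he)).1
  have hmax : maxTime Λ ≤ v := Finset.sup_le fun e he => Int.toNat_le.2 (hΛ e he).2
  refine ⟨?_, ?_⟩
  · have h := torus_rp_bond (S := S) r.ρ r.continuous hβ (by omega) hFcm hFcb hFc hΛpos (by omega)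
    rw [rpForms_re_integral_conj_ofReal_mul] at h
    exact h
  · have h := torus_rp_site (S := S) r.ρ r.continuous hβ hFcm hFcb hFc hΛpos (by omega)
    rw [rpForms_re_integral_conj_ofReal_mul] at h
    exact h

/-! ### The registered stub -/

/-- `stub_rpFormsCS` — **the two reflection-positive forms of the odd torus are symmetric and positive
semi-definite, hence Cauchy–Schwarz** (line `Sketch`, reshape 17-RP, of crux stmt-QuantumFields-15828;
tree `torus_rp_bond` / `torus_rp_site` of `CriticalContinuumLimit.AdmissibleGap`, symmetry from `Θ_T`- and
translation-invariance of the torus Wilson state and the lift intertwiners `gaugeTimeReflect_torusLift` /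
`gaugeTimeShift_torusLift`): for real bounded measurable cylinder observables `X, Y` of `ℤ⁴` supported on
links based at times `0 ≤ x₀ ≤ v` with `v + 2 ≤ S`, on the torus of side `2S+1` at `β ≥ 0` the bond form
`Q₀(X,Y) = ∫ X(Θ Ũ) Y(Ũ)` and the site form `Q₁(X,Y) = ∫ X(Θ Ũ) Y(τ Ũ)` (`Ũ = torusLift (2S+1) U`,
`Θ = gaugeTimeReflect`, `τ = gaugeTimeShift`) satisfy `Qᵢ(X,Y)² ≤ Qᵢ(X,X) Qᵢ(Y,Y)` and `Qᵢ(X,X) ≥ 0`.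
[folklore] -/
theorem stub_rpFormsCS :
    ∀ (G : Type) [Group G] [TopologicalSpace G] [IsTopologicalGroup G] [CompactSpace G]
      [MeasurableSpace G] [BorelSpace G] (r : LatticeRep G),
      ∀ (β : ℝ), 0 ≤ β → ∀ (S v : ℕ), v + 2 ≤ S →
      ∀ (X Y : LGConfig 4 G → ℝ) (ΛX ΛY : Finset (Literature.MathematicalPhysics.QuantumLattice.ZdEdge 4)), Measurable X → Measurable Y →
      (∃ C : ℝ, ∀ U, |X U| ≤ C) → (∃ C : ℝ, ∀ U, |Y U| ≤ C) → IsCylinder X ΛX → IsCylinder Y ΛY →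
      (∀ e ∈ ΛX, 0 ≤ e.1 0 ∧ e.1 0 ≤ (v : ℤ)) → (∀ e ∈ ΛY, 0 ≤ e.1 0 ∧ e.1 0 ≤ (v : ℤ)) →
      (∫ U : GaugeConfig 4 (2 * S + 1) G, X (gaugeTimeReflect (torusLift (2 * S + 1) U)) *
          Y (torusLift (2 * S + 1) U) ∂(wilsonMeasure r.ρ β)) ^ 2 ≤
        (∫ U : GaugeConfig 4 (2 * S + 1) G, X (gaugeTimeReflect (torusLift (2 * S + 1) U)) *
          X (torusLift (2 * S + 1) U) ∂(wilsonMeasure r.ρ β)) *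
        (∫ U : GaugeConfig 4 (2 * S + 1) G, Y (gaugeTimeReflect (torusLift (2 * S + 1) U)) *
          Y (torusLift (2 * S + 1) U) ∂(wilsonMeasure r.ρ β)) ∧
      (∫ U : GaugeConfig 4 (2 * S + 1) G, X (gaugeTimeReflect (torusLift (2 * S + 1) U)) *
          Y (gaugeTimeShift (torusLift (2 * S + 1) U)) ∂(wilsonMeasure r.ρ β)) ^ 2 ≤
        (∫ U : GaugeConfig 4 (2 * S + 1) G, X (gaugeTimeReflect (torusLift (2 * S + 1) U)) *
          X (gaugeTimeShift (torusLift (2 * S + 1) U)) ∂(wilsonMeasure r.ρ β)) *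
        (∫ U : GaugeConfig 4 (2 * S + 1) G, Y (gaugeTimeReflect (torusLift (2 * S + 1) U)) *
          Y (gaugeTimeShift (torusLift (2 * S + 1) U)) ∂(wilsonMeasure r.ρ β)) ∧
      0 ≤ ∫ U : GaugeConfig 4 (2 * S + 1) G, X (gaugeTimeReflect (torusLift (2 * S + 1) U)) *
          X (torusLift (2 * S + 1) U) ∂(wilsonMeasure r.ρ β) ∧
      0 ≤ ∫ U : GaugeConfig 4 (2 * S + 1) G, X (gaugeTimeReflect (torusLift (2 * S + 1) U)) *
          X (gaugeTimeShift (torusLift (2 * S + 1) U)) ∂(wilsonMeasure r.ρ β) := by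
  intro G _ _ _ _ _ _ r β hβ S v hv X Y ΛX ΛY hXm hYm hXb hYb hXc hYc hΛX hΛY
  haveI := isProbabilityMeasure_wilsonMeasure (d := 4) (L := 2 * S + 1) r.ρ r.continuous β
  obtain ⟨CX, hCX⟩ := hXb
  obtain ⟨CY, hCY⟩ := hYb
  -- positivity of both forms on the real combinations `X + tY`
  have psd : ∀ t : ℝ,
      0 ≤ ∫ U : GaugeConfig 4 (2 * S + 1) G, (X (gaugeTimeReflect (torusLift (2 * S + 1) U)) +
          t * Y (gaugeTimeReflect (torusLift (2 * S + 1) U))) *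
          (X (torusLift (2 * S + 1) U) + t * Y (torusLift (2 * S + 1) U)) ∂(wilsonMeasure r.ρ β) ∧
      0 ≤ ∫ U : GaugeConfig 4 (2 * S + 1) G, (X (gaugeTimeReflect (torusLift (2 * S + 1) U)) +
          t * Y (gaugeTimeReflect (torusLift (2 * S + 1) U))) *
          (X (gaugeTimeShift (torusLift (2 * S + 1) U)) + t * Y (gaugeTimeShift (torusLift (2 * S + 1) U)))
          ∂(wilsonMeasure r.ρ β) :=
    fun t => rpForms_rp_real r hβ hv (F := fun W => X W + t * Y W) (hXm.add (hYm.const_mul t))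
      ⟨CX + |t| * CY, fun W => (abs_add_le _ _).trans (add_le_add (hCX W)
        (by rw [abs_mul]; exact mul_le_mul_of_nonneg_left (hCY W) (abs_nonneg t)))⟩
      (rpForms_isCylinder_add_mul hXc hYc t)
      (fun e he => (Finset.mem_union.1 he).elim (hΛX e) (hΛY e))
  -- measurability of the four real functions on the torus
  have mΘ : Measurable fun U : GaugeConfig 4 (2 * S + 1) G => gaugeTimeReflect (torusLift (2 * S + 1) U) :=
    measurable_gaugeTimeReflect.comp (measurable_torusLift _)
  have mτ : Measurable fun U : GaugeConfig 4 (2 * S + 1) G => gaugeTimeShift (torusLift (2 * S + 1) U) :=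
    measurable_gaugeTimeShift.comp (measurable_torusLift _)
  have mXΘ : Measurable fun U : GaugeConfig 4 (2 * S + 1) G => X (gaugeTimeReflect (torusLift (2 * S + 1) U)) :=
    hXm.comp mΘ
  have mYΘ : Measurable fun U : GaugeConfig 4 (2 * S + 1) G => Y (gaugeTimeReflect (torusLift (2 * S + 1) U)) :=
    hYm.comp mΘ
  have mX : Measurable fun U : GaugeConfig 4 (2 * S + 1) G => X (torusLift (2 * S + 1) U) :=
    hXm.comp (measurable_torusLift _)
  have mY : Measurable fun U : GaugeConfig 4 (2 * S + 1) G => Y (torusLift (2 * S + 1) U) :=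
    hYm.comp (measurable_torusLift _)
  have mXτ : Measurable fun U : GaugeConfig 4 (2 * S + 1) G => X (gaugeTimeShift (torusLift (2 * S + 1) U)) :=
    hXm.comp mτ
  have mYτ : Measurable fun U : GaugeConfig 4 (2 * S + 1) G => Y (gaugeTimeShift (torusLift (2 * S + 1) U)) :=
    hYm.comp mτ
  have bXΘ : ∃ C : ℝ, ∀ U : GaugeConfig 4 (2 * S + 1) G, |X (gaugeTimeReflect (torusLift (2 * S + 1) U))| ≤ C :=
    ⟨CX, fun _ => hCX _⟩
  have bYΘ : ∃ C : ℝ, ∀ U : GaugeConfig 4 (2 * S + 1) G, |Y (gaugeTimeReflect (torusLift (2 * S + 1) U))| ≤ C :=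
    ⟨CY, fun _ => hCY _⟩
  have bX : ∃ C : ℝ, ∀ U : GaugeConfig 4 (2 * S + 1) G, |X (torusLift (2 * S + 1) U)| ≤ C :=
    ⟨CX, fun _ => hCX _⟩
  have bY : ∃ C : ℝ, ∀ U : GaugeConfig 4 (2 * S + 1) G, |Y (torusLift (2 * S + 1) U)| ≤ C :=
    ⟨CY, fun _ => hCY _⟩
  have bXτ : ∃ C : ℝ, ∀ U : GaugeConfig 4 (2 * S + 1) G, |X (gaugeTimeShift (torusLift (2 * S + 1) U))| ≤ C :=
    ⟨CX, fun _ => hCX _⟩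
  have bYτ : ∃ C : ℝ, ∀ U : GaugeConfig 4 (2 * S + 1) G, |Y (gaugeTimeShift (torusLift (2 * S + 1) U))| ≤ C :=
    ⟨CY, fun _ => hCY _⟩
  have bond := rpForms_sq_integral_le (μ := wilsonMeasure (d := 4) (L := 2 * S + 1) r.ρ β)
    (rpForms_integrable_mul mXΘ mX bXΘ bX) (rpForms_integrable_mul mXΘ mY bXΘ bY)
    (rpForms_integrable_mul mYΘ mX bYΘ bX) (rpForms_integrable_mul mYΘ mY bYΘ bY)
    (fun t => (psd t).1) (rpForms_bond_symm r β Y X)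
  have site := rpForms_sq_integral_le (μ := wilsonMeasure (d := 4) (L := 2 * S + 1) r.ρ β)
    (rpForms_integrable_mul mXΘ mXτ bXΘ bXτ) (rpForms_integrable_mul mXΘ mYτ bXΘ bYτ)
    (rpForms_integrable_mul mYΘ mXτ bYΘ bXτ) (rpForms_integrable_mul mYΘ mYτ bYΘ bYτ)
    (fun t => (psd t).2) (rpForms_site_symm r β Y X)
  exact ⟨bond.1, site.1, bond.2, site.2⟩

end Summit.QuantumFields.YangMills.Theorems.ContinuumLegGivenGap

end
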